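import Summits.AtomisticToContinuum.HydrodynamicLimit.Theorems.OneFlightGossipEngineClampedCurrentsDockCubicChannel
import HarnessLib

/-!
# Definitions of line `Sketch` (card `gibbs-budget-coherence-bridge`) of crux `ClampedTransferDock` (stmt-AtomisticToContinuum-16665)

Support file (`--supports stmt-AtomisticToContinuum-16665`) of the registered skeleton `Cruxes/ClampedTransferDock/Lines/Sketch.lean`
(lead prover-line-stmt-AtomisticToContinuum-16665-0): the objects and the four route-internal propositions the skeleton's stubs quote —
the dyadic drift test `DriftBad` (ball counts / ball mean velocities), the static drift price `MesoDriftTails`, the equilibrium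
large deviation `EquilibriumNonBlobCoherenceLD` (v2) and the joint `BoundedCoherentContentVanishes` of the two bridge stubs — together
with the measurability of the drift test (countable union over dyadic radii of measurable conditions), which every stub file needs
to give the window integrals of the non-blob indicator their meaning. Route-internal propositions in the vocabulary of the crux, not
cited facts. See the skeleton header for the three repairs of the card's typed statements (dyadic radii; `MesoDriftTails` chooses
`r₀` after `D₀`; `EquilibriumNonBlobCoherenceLD` chooses a drift-level ceiling `D₁` and takes measurable radial weights).
-/

noncomputable section

namespace Summit.AtomisticToContinuum.HydrodynamicLimit.Theorems.ClampedTransferDockBridge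

open scoped BigOperators ENNReal Classical
open MeasureTheory Set Filter
open Literature.MathematicalPhysics.KineticTheory Literature.Analysis.FluidPDE Literature.Analysis.FunctionSpaces

/-! ## §1 The drift test -/

/-- Number of particles within minimal-image distance `r` of particle `i` (particle `i` included). [folklore] -/
def ballCount (r : ℝ) {N : ℕ} (c : Config (N + 1) (Fin 3) T3) (i : Fin (N + 1)) : ℕ :=
  (Finset.univ.filter (fun j : Fin (N + 1) => Torus.euclidDist (c j).1 (c i).1 ≤ r)).card

/-- Empirical mean velocity of the ball of radius `r` around particle `i` (junk `0`-scaled if the ball were empty; it never is). [folklore] -/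
def ballMeanVel (r : ℝ) {N : ℕ} (c : Config (N + 1) (Fin 3) T3) (i : Fin (N + 1)) : V3 :=
  ((ballCount r c i : ℝ)⁻¹) •
    ∑ j ∈ Finset.univ.filter (fun j : Fin (N + 1) => Torus.euclidDist (c j).1 (c i).1 ≤ r), (c j).2

/-- Particle `i` of the configuration `c` is DRIFT-BAD at levels `(κ, r₀, D₀)` against the velocity field `u`: at some DYADIC
mesoscopic radius `κ (N+1)^{-1/3} 2^k ≤ r₀` the empirical mean velocity of the ball around it deviates from `u(x_i)` by more
than `D₀` (a comoving blob / Galilean droplet at that scale) — route-internal definition of line Sketch, crux ClampedTransferDock, not a cited fact -/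
def DriftBad (κ r₀ D₀ : ℝ) (u : T3 → V3) {N : ℕ} (c : Config (N + 1) (Fin 3) T3) (i : Fin (N + 1)) : Prop :=
  ∃ k : ℕ, κ * ((N : ℝ) + 1) ^ (-(1 / 3 : ℝ)) * 2 ^ k ≤ r₀ ∧
    D₀ < ‖ballMeanVel (κ * ((N : ℝ) + 1) ^ (-(1 / 3 : ℝ)) * 2 ^ k) c i - u (c i).1‖

/-! ## §2 The propositions -/

/-- **`MesoDriftTails` (conjecture-grade; true law, static, fixed level).** Along the true pre-shock law, at every fixed drift
level `D₀` and below a radius `r₀ = r₀(D₀)` (chosen after the solution on `[0, t]` and `D₀`), the fraction of drift-bad particles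
at time `s` against the Euler field `u_s` vanishes as `N → ∞` then `κ → ∞`, uniformly in `s ∈ [0, t]` — registered stub signature
(`stub_mesoDriftTails`) of line Sketch, crux ClampedTransferDock — route-internal proposition in the vocabulary of the crux, not a cited fact -/
def MesoDriftTails : Prop :=
  ∀ (a₀ θ₀ : T3 → ℝ) (u₀ : T3 → V3), Continuous a₀ → Continuous θ₀ → Continuous u₀ →
    (∀ x, 0 < a₀ x) → (∀ x, 0 < θ₀ x) →
    ∃ σ₀ : ℝ, 0 < σ₀ ∧ ∀ σ : ℝ, 0 < σ → σ < σ₀ →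
    ∀ (T : ℝ) (ρ θ : ℝ → T3 → ℝ) (u : ℝ → T3 → V3), IsHardSphereEulerSolution σ T ρ u θ →
    ∀ Φ : (N : ℕ) → HardSphereFlow (Torus.geometry (Fin 3)) (hsDiameter σ N) (N + 1),
      TendstoHydroFieldsAt (fun N => localGibbsLaw σ a₀ u₀ θ₀ N (Φ N)) Φ ρ u θ 0 →
      ∀ t ∈ Set.Ico 0 T, ∀ D₀ : ℝ, 0 < D₀ → ∃ r₀ : ℝ, 0 < r₀ ∧ ∀ ε : ℝ, 0 < ε →
      ∃ κ₀ : ℝ, 0 < κ₀ ∧ ∀ κ : ℝ, κ₀ ≤ κ → ∃ N₀ : ℕ, ∀ N : ℕ, N₀ ≤ N → ∀ s ∈ Set.Icc 0 t,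
        ∫⁻ z, ENNReal.ofReal (((N : ℝ) + 1)⁻¹ * ∑ i : Fin (N + 1),
            (if DriftBad κ r₀ D₀ (u s) ((Φ N).flow s z) i then (1 : ℝ) else 0))
          ∂(localGibbsLaw σ a₀ u₀ θ₀ N (Φ N)) ≤ ENNReal.ofReal ε

/-- **`EquilibriumNonBlobCoherenceLD` (conjecture-grade; equilibrium dynamics — the line's one new input), v2.** Under the
GLOBAL Gibbs law (constant activity `ab`, zero drift, temperature `θb`; stationary, window `[0, w]`, `w = τ (N+1)^{-1/3}`):
peculiar velocities `W = v − u(x)` against an arbitrary continuous field `u` with `‖u‖ ≤ U`, `L`-Lipschitz; coherence tested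
against an arbitrary measurable radial weight `R` vanishing below `K⋆²` with `|R(x, s′)| ≤ |s′|` (S6′'s class); per particle
only the cubic content at speeds in `(K⋆, K]` at times when the particle is NOT drift-bad is counted (`Y ≤ K³`). CLAIM: below a
drift-level ceiling `D₁ = D₁(U, L, K⋆, K, η)`, for every target rate `r` the probability that the particle average of the coherent
bounded non-blob content exceeds `δ` is `≤ e^{−r(N+1)}` once `κ`, then `τ`, then `N` are large — super-exponential IN `τ`. Registered
stub signature (`stub_equilibriumCoherenceLD`) of line Sketch, crux ClampedTransferDock — route-internal proposition in the vocabulary of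
the crux, not a cited fact -/
def EquilibriumNonBlobCoherenceLD : Prop :=
  ∀ (ab θb : ℝ), 0 < ab → 0 < θb → ∃ σ₀ : ℝ, 0 < σ₀ ∧ ∀ σ : ℝ, 0 < σ → σ < σ₀ →
    ∀ Φ : (N : ℕ) → HardSphereFlow (Torus.geometry (Fin 3)) (hsDiameter σ N) (N + 1),
    ∀ (U L Kstar K η : ℝ), 0 ≤ U → 0 ≤ L → 0 < Kstar → Kstar ≤ K → 0 < η →
    ∃ D₁ : ℝ, 0 < D₁ ∧ ∀ D₀ : ℝ, 0 < D₀ → D₀ ≤ D₁ → ∀ (r₀ δ r : ℝ), 0 < r₀ → 0 < δ → 0 < r →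
    ∃ κ₀ : ℝ, 0 < κ₀ ∧ ∀ κ : ℝ, κ₀ ≤ κ → ∃ τ₀ : ℝ, 0 < τ₀ ∧ ∀ τ : ℝ, τ₀ ≤ τ →
    ∃ N₀ : ℕ, ∀ N : ℕ, N₀ ≤ N →
    ∀ u : T3 → V3, Continuous u → (∀ x, ‖u x‖ ≤ U) → (∀ x y, ‖u x - u y‖ ≤ L * Torus.euclidDist x y) →
    ∀ R : T3 → ℝ → ℝ, Measurable (fun p : T3 × ℝ => R p.1 p.2) →
      (∀ x s', s' ≤ Kstar ^ 2 → R x s' = 0) → (∀ x s', |R x s'| ≤ |s'|) →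
      (let w : ℝ := τ * ((N : ℝ) + 1) ^ (-(1 / 3 : ℝ))
       let G := localGibbsLaw σ (fun _ => ab) (fun _ => (0 : V3)) (fun _ => θb) N (Φ N)
       let W := fun (i : Fin (N + 1)) (r : ℝ) (z : Config (N + 1) (Fin 3) T3) =>
         ((Φ N).flow r z i).2 - u ((Φ N).flow r z i).1
       let cub := fun (i : Fin (N + 1)) (z : Config (N + 1) (Fin 3) T3) =>
         w⁻¹ * ∫ r in (0 : ℝ)..w, ‖W i r z‖ ^ 3
       let Y := fun (i : Fin (N + 1)) (z : Config (N + 1) (Fin 3) T3) =>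
         w⁻¹ * ∫ r in (0 : ℝ)..w,
           (if Kstar < ‖W i r z‖ ∧ ‖W i r z‖ ≤ K ∧ ¬ DriftBad κ r₀ D₀ u ((Φ N).flow r z) i
            then ‖W i r z‖ ^ 3 else 0)
       let qbar := fun (i : Fin (N + 1)) (z : Config (N + 1) (Fin 3) T3) =>
         w⁻¹ • ∫ r in (0 : ℝ)..w, (R ((Φ N).flow r z i).1 (‖W i r z‖ ^ 2)) • W i r z
       G {z | δ < ((N : ℝ) + 1)⁻¹ * ∑ i : Fin (N + 1), (if η * cub i z < ‖qbar i z‖ then Y i z else 0)}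
         ≤ ENNReal.ofReal (Real.exp (-(r * ((N : ℝ) + 1)))))

/-- **`BoundedCoherentContentVanishes` (the joint between the two bridge stubs; true law).** Along the true pre-shock law,
below a drift-level ceiling `D₁ = D₁(t, K⋆, K, η)`, the mean of the particle average of the coherent bounded non-blob
suprathermal content over the window `[s, s+w]` (peculiar velocities and drift test against the Euler field `u_s` frozen at the
window start, weight `R` in S6′'s class) is `≤ ε` once `κ`, then `τ`, then `N` are large, uniformly in the weight and in
`s ∈ [0, t]`. (`stub_bridgeTransfer`: from `EquilibriumNonBlobCoherenceLD` by the global-Gibbs budget; consumed by `stub_bridgeDomination`.)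
Route-internal proposition of line Sketch, crux ClampedTransferDock, not a cited fact -/
def BoundedCoherentContentVanishes : Prop :=
  ∀ (a₀ θ₀ : T3 → ℝ) (u₀ : T3 → V3), Continuous a₀ → Continuous θ₀ → Continuous u₀ →
    (∀ x, 0 < a₀ x) → (∀ x, 0 < θ₀ x) →
    ∃ σ₀ : ℝ, 0 < σ₀ ∧ ∀ σ : ℝ, 0 < σ → σ < σ₀ →
    ∀ (T : ℝ) (ρ θ : ℝ → T3 → ℝ) (u : ℝ → T3 → V3), IsHardSphereEulerSolution σ T ρ u θ →
    ∀ Φ : (N : ℕ) → HardSphereFlow (Torus.geometry (Fin 3)) (hsDiameter σ N) (N + 1),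
    TendstoHydroFieldsAt (fun N => localGibbsLaw σ a₀ u₀ θ₀ N (Φ N)) Φ ρ u θ 0 →
    ∀ t ∈ Set.Ico 0 T, ∀ (Kstar K η : ℝ), 0 < Kstar → Kstar ≤ K → 0 < η →
    ∃ D₁ : ℝ, 0 < D₁ ∧ ∀ D₀ : ℝ, 0 < D₀ → D₀ ≤ D₁ → ∀ (r₀ ε : ℝ), 0 < r₀ → 0 < ε →
    ∃ κ₀ : ℝ, 0 < κ₀ ∧ ∀ κ : ℝ, κ₀ ≤ κ → ∃ τ₀ : ℝ, 0 < τ₀ ∧ ∀ τ : ℝ, τ₀ ≤ τ → ∃ N₀ : ℕ, ∀ N : ℕ, N₀ ≤ N →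
    ∀ R : T3 → ℝ → ℝ, Measurable (fun p : T3 × ℝ => R p.1 p.2) →
      (∀ x s', s' ≤ Kstar ^ 2 → R x s' = 0) → (∀ x s', |R x s'| ≤ |s'|) →
    ∀ s ∈ Set.Icc 0 t,
      (let w : ℝ := τ * ((N : ℝ) + 1) ^ (-(1 / 3 : ℝ))
       let P := localGibbsLaw σ a₀ u₀ θ₀ N (Φ N)
       let W := fun (i : Fin (N + 1)) (r : ℝ) (z : Config (N + 1) (Fin 3) T3) =>
         ((Φ N).flow r z i).2 - u s ((Φ N).flow r z i).1
       let cub := fun (i : Fin (N + 1)) (z : Config (N + 1) (Fin 3) T3) =>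
         w⁻¹ * ∫ r in s..(s + w), ‖W i r z‖ ^ 3
       let Y := fun (i : Fin (N + 1)) (z : Config (N + 1) (Fin 3) T3) =>
         w⁻¹ * ∫ r in s..(s + w),
           (if Kstar < ‖W i r z‖ ∧ ‖W i r z‖ ≤ K ∧ ¬ DriftBad κ r₀ D₀ (u s) ((Φ N).flow r z) i
            then ‖W i r z‖ ^ 3 else 0)
       let qbar := fun (i : Fin (N + 1)) (z : Config (N + 1) (Fin 3) T3) =>
         w⁻¹ • ∫ r in s..(s + w), (R ((Φ N).flow r z i).1 (‖W i r z‖ ^ 2)) • W i r z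
       ∫⁻ z, ENNReal.ofReal (((N : ℝ) + 1)⁻¹ * ∑ i : Fin (N + 1),
              (if η * cub i z < ‖qbar i z‖ then Y i z else 0)) ∂P ≤ ENNReal.ofReal ε)

/-! ## §3 Measurability of the drift test -/

variable {N : ℕ}

/-- The minimal-image distance between the positions of two particles is a measurable configuration functional. [folklore] -/
theorem measurable_euclidDist_pos (i j : Fin (N + 1)) :
    Measurable fun c : Config (N + 1) (Fin 3) T3 => Torus.euclidDist (c j).1 (c i).1 := by
  -- adapted from `JParityClosureOddContactSymmetryTubeStatRegular.measurable_euclidDist_comp`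
  have hj : Measurable fun c : Config (N + 1) (Fin 3) T3 => (c j).1 := (measurable_pi_apply j).fst
  have hi : Measurable fun c : Config (N + 1) (Fin 3) T3 => (c i).1 := (measurable_pi_apply i).fst
  simp only [Torus.euclidDist_eq]
  exact (Torus.measurable_reprSym.comp (hj.sub hi)).norm

/-- Ball membership `{d(x_j, x_i) ≤ r}` is a measurable set of configurations. [folklore] -/
theorem measurableSet_ball_mem (r : ℝ) (i j : Fin (N + 1)) :
    MeasurableSet {c : Config (N + 1) (Fin 3) T3 | Torus.euclidDist (c j).1 (c i).1 ≤ r} :=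
  measurableSet_le (measurable_euclidDist_pos i j) measurable_const

/-- The ball count as a sum of indicators. [folklore] -/
theorem ballCount_eq_sum (r : ℝ) (c : Config (N + 1) (Fin 3) T3) (i : Fin (N + 1)) :
    (ballCount r c i : ℝ) = ∑ j : Fin (N + 1), (if Torus.euclidDist (c j).1 (c i).1 ≤ r then (1 : ℝ) else 0) := by
  unfold ballCount
  rw [Finset.card_filter]
  push_cast
  rfl

/-- The ball mean velocity as an indicator-weighted sum. [folklore] -/
theorem ballMeanVel_eq_sum (r : ℝ) (c : Config (N + 1) (Fin 3) T3) (i : Fin (N + 1)) :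
    ballMeanVel r c i = (∑ j : Fin (N + 1), (if Torus.euclidDist (c j).1 (c i).1 ≤ r then (1 : ℝ) else 0))⁻¹ •
      ∑ j : Fin (N + 1), (if Torus.euclidDist (c j).1 (c i).1 ≤ r then (c j).2 else 0) := by
  unfold ballMeanVel
  rw [ballCount_eq_sum, Finset.sum_filter]

/-- The ball count is a measurable configuration functional. [folklore] -/
theorem measurable_ballCount (r : ℝ) (i : Fin (N + 1)) :
    Measurable fun c : Config (N + 1) (Fin 3) T3 => (ballCount r c i : ℝ) := by
  simp_rw [ballCount_eq_sum]
  exact Finset.measurable_sum _ fun j _ => Measurable.ite (measurableSet_ball_mem r i j) measurable_const measurable_const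

/-- The ball mean velocity is a measurable configuration functional. [folklore] -/
theorem measurable_ballMeanVel (r : ℝ) (i : Fin (N + 1)) :
    Measurable fun c : Config (N + 1) (Fin 3) T3 => ballMeanVel r c i := by
  simp_rw [ballMeanVel_eq_sum]
  have h1 : Measurable fun c : Config (N + 1) (Fin 3) T3 =>
      ∑ j : Fin (N + 1), (if Torus.euclidDist (c j).1 (c i).1 ≤ r then (1 : ℝ) else 0) :=
    Finset.measurable_sum _ fun j _ => Measurable.ite (measurableSet_ball_mem r i j) measurable_const measurable_const
  have h2 : Measurable fun c : Config (N + 1) (Fin 3) T3 =>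
      ∑ j : Fin (N + 1), (if Torus.euclidDist (c j).1 (c i).1 ≤ r then (c j).2 else 0) :=
    Finset.measurable_sum _ fun j _ =>
      Measurable.ite (measurableSet_ball_mem r i j) (measurable_pi_apply j).snd measurable_const
  exact h1.inv.smul h2

/-- **The drift test is measurable**: for a continuous field `u`, `{c | DriftBad κ r₀ D₀ u c i}` is a measurable set of
configurations (a countable union over the dyadic radii of measurable conditions). [folklore] -/
theorem measurableSet_driftBad (κ r₀ D₀ : ℝ) {u : T3 → V3} (hu : Continuous u) (i : Fin (N + 1)) :
    MeasurableSet {c : Config (N + 1) (Fin 3) T3 | DriftBad κ r₀ D₀ u c i} := by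
  have e : {c : Config (N + 1) (Fin 3) T3 | DriftBad κ r₀ D₀ u c i} =
      ⋃ k : ℕ, ({_c : Config (N + 1) (Fin 3) T3 | κ * ((N : ℝ) + 1) ^ (-(1 / 3 : ℝ)) * 2 ^ k ≤ r₀} ∩
        {c | D₀ < ‖ballMeanVel (κ * ((N : ℝ) + 1) ^ (-(1 / 3 : ℝ)) * 2 ^ k) c i - u (c i).1‖}) := by
    ext c
    simp only [DriftBad, mem_setOf_eq, mem_iUnion, mem_inter_iff]
  rw [e]
  refine MeasurableSet.iUnion fun k => (measurableSet_setOf.2 measurable_const).inter ?_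
  exact measurableSet_lt measurable_const
    (((measurable_ballMeanVel _ i).sub (hu.measurable.comp (measurable_pi_apply i).fst)).norm)

/-- The drift-bad indicator count `Σ_i 1{DriftBad}` is a measurable configuration functional. [folklore] -/
theorem measurable_driftBadCount (κ r₀ D₀ : ℝ) {u : T3 → V3} (hu : Continuous u) :
    Measurable fun c : Config (N + 1) (Fin 3) T3 =>
      ∑ i : Fin (N + 1), (if DriftBad κ r₀ D₀ u c i then (1 : ℝ) else 0) :=
  Finset.measurable_sum _ fun i _ => Measurable.ite (measurableSet_driftBad κ r₀ D₀ hu i) measurable_const measurable_const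

end Summit.AtomisticToContinuum.HydrodynamicLimit.Theorems.ClampedTransferDockBridge

end
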